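import Literature.MathematicalPhysics.QuantumLattice.FermionPartialTrace
import Literature.MathematicalPhysics.QuantumLattice.WindowEntropyConcavity
import HarnessLib

/-!
# Strong subadditivity of the von Neumann entropy for even states of a lattice fermion system
# (Araki–Moriya: SSA for the Fermion algebra)

Topic `MathematicalPhysics/QuantumLattice`, namespace `Literature.MathematicalPhysics.QuantumLattice`.

For an EVEN density matrix `ρ` on the Jordan–Wigner = Fock space of a finite linearly ordered site type
`Λ'` (two spin states per site) and two regions `I, J ⊆ Λ'` — given, as everywhere in the tree, by
injections of sites `φ_I, φ_J` together with injections `φ_K, φ_U` onto `I ∩ J` and `I ∪ J` — the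
entropies of the restrictions of the state to the local CAR algebras (`fermionPartialTrace`,
`FermionPartialTrace.lean`) satisfy STRONG SUBADDITIVITY

  `S(ρ_{I ∪ J}) + S(ρ_{I ∩ J}) ≤ S(ρ_I) + S(ρ_J)`          (`fermion_strongSubadditivity`).

This is Araki–Moriya's SSA for the Fermion lattice algebra [cite: ArakiMoriya2003, Theorem 3.8 / §10 (SSA
for `Θ`-even states of the CAR algebra)], here for finite systems. In the Jordan–Wigner matrix picture the
subalgebras `𝔄(I)`, `𝔄(J)` are NOT tensor factors (strings), so the tensor-product SSA of Lieb–Ruskai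
(tree THEOREM `strongSubadditivity_of_relEntropy_partialTrace_le` with `relEntropy_partialTrace_le_holds`,
`InformationTheory/Entropy`) does not apply verbatim. PROOF (the standard reduction): the entropy of a
CAR marginal only depends on the region (`vonNeumannEntropy_fermionPartialTrace_eq_of_range_eq`), so after
restricting to `I ∪ J` we may re-order the sites into the three consecutive blocks
`P = I ∖ J < Q = I ∩ J < R = J ∖ I` (site type `P ⊕ₗ (Q ⊕ₗ R)`; the transported state is the marginal
along the block injection, still even); in this order `I = P ∪ Q` is an INITIAL segment (CAR marginal =
spin marginal for every state, `toSpin_fermionPartialTrace_of_isLowerSet`), `J = Q ∪ R` is a FINAL segment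
(CAR marginal = spin marginal for even states — the strings below the block cancel,
`toSpin_fermionPartialTrace_of_isUpperSet_of_even`), `Q` is an initial segment of `J`, and the tensor SSA
on `ℋ_P ⊗ ℋ_Q ⊗ ℋ_R` concludes.

Contents: §1 the tensor SSA in the site-indexed vocabulary `Op (A ⊕ (S ⊕ B)) q` / `spinPartialTrace`
(`spin_strongSubadditivity`, and `spin_strongSubadditivity'` on any site type identified with three blocks
— the pattern of `WindowEntropyIncrement.lean`); §2 the block order embeddings of `P ⊕ₗ (Q ⊕ₗ R)` and
the fermionic SSA in block form (`fermion_strongSubadditivity_blocks`); §3 the general statement.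
Everything is PROVED; no named fact; the only definitions are block-embedding bookkeeping (`embS`,
`blockInlO`, `blockInrO`, `blockPQO`, with bodies). Special cases: SUBADDITIVITY (`I ∩ J = ∅`) and the
chain rule bound `S(ρ_{≤k}) − S(ρ_{<k}) ≤ S(ρ_W) − S(ρ_{W ∖ k})` used by Markov / MED entropy bounds on the
pressure (Poulin–Hastings 2011) — consumers: the thermal free-energy certificates of the Hubbard programme.

## References

* H. Araki, H. Moriya, *Equilibrium statistical mechanics of Fermion lattice systems*, Rev. Math. Phys.
  15 (2003) 93–198, §3 (entropy, SSA for the Fermion algebra: Thm. 3.8), §4.1–4.2, §10. [ArakiMoriya2003]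
* E. H. Lieb, M. B. Ruskai, *Proof of the strong subadditivity of quantum-mechanical entropy*, J. Math.
  Phys. 14 (1973) 1938–1941. [LiebRuskai1973]
* M. A. Nielsen, I. L. Chuang, *Quantum Computation and Quantum Information* (CUP 2010), Thm. 11.14,
  §11.4.1. [NielsenChuang2010]
* D. Poulin, M. B. Hastings, *Markov entropy decomposition: a variational dual for quantum belief
  propagation*, Phys. Rev. Lett. 106 (2011) 080403 (entropy chain rule + SSA ⇒ free-energy lower bounds).
  [PoulinHastings2011]
-/

noncomputable section

-- Instance synthesis for `DecidableEq (Finset (Orb (P ⊕ₗ Q)))` / `Fintype (TensorIndex (P ⊕ₗ (Q ⊕ₗ R)) 4)`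
-- on the lexicographic block site types unfolds the order synonyms and exceeds the default size bound
-- (cf. the implementation note of `InfVolFermionState.lean`).
set_option synthInstance.maxSize 1024

namespace Literature.MathematicalPhysics.QuantumLattice

open Matrix Finset HubbardWave0
open scoped ComplexOrder
open Literature.Computability.QuantumComplexity (traceLeft traceRight IsDensity traceLeft_apply
  traceRight_apply)
open Literature.InformationTheory.Entropy (vonNeumannEntropy traceLast traceLast_apply
  relEntropy_partialTrace_le_holds strongSubadditivity_of_relEntropy_partialTrace_le
  traceRight_traceLeft_eq_traceLeft_traceLast vonNeumannEntropy_submatrix_equiv)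

/-! ### §1. Strong subadditivity in the site-indexed spin vocabulary -/

section Spin

variable {A S B : Type} [Fintype A] [DecidableEq A] [Fintype S] [DecidableEq S] [Fintype B]
  [DecidableEq B] {q : ℕ}

/-- The embedding of the middle block `S ↪ A ⊕ (S ⊕ B)`. [cite: NielsenChuang2010, Theorem 11.14] -/
def embS (A S B : Type) : S ↪ A ⊕ (S ⊕ B) :=
  (Function.Embedding.inl : S ↪ S ⊕ B).trans (Function.Embedding.inr : S ⊕ B ↪ A ⊕ (S ⊕ B))

/-- (m5) The `S`-marginal is `Tr_A Tr_B` in product coordinates. [cite: NielsenChuang2010, §2.4.3 eq. (2.178)] -/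
theorem spinPartialTrace_embS_eq_traceLeft_traceLast (σ : Op (A ⊕ (S ⊕ B)) q) :
    spinPartialTrace (embS A S B) σ = traceLeft (traceLast (toProd3 σ)) := by
  rw [embS, spinPartialTrace_trans, spinPartialTrace_inr_eq_traceLeft,
    spinPartialTrace_inl_eq_traceRight_submatrix, Matrix.submatrix_submatrix, Equiv.self_comp_symm,
    Matrix.submatrix_id_id, traceRight_traceLeft_eq_traceLeft_traceLast]

/-- **Strong subadditivity, three-block window (Lieb–Ruskai).** For a density matrix `σ` of the window
`A ⊕ (S ⊕ B)`: `S(σ) + S(σ_S) ≤ S(σ_{AS}) + S(σ_{SB})`. The tree THEOREM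
`strongSubadditivity_of_relEntropy_partialTrace_le` (product coordinates `A × S × B`), moved to
`spinPartialTrace` marginals. [cite: LiebRuskai1973, Theorem 2] [cite: NielsenChuang2010, Theorem 11.14] -/
theorem spin_strongSubadditivity (σ : Op (A ⊕ (S ⊕ B)) q) (hσ : σ.PosSemidef) (htr : σ.trace = 1) :
    vonNeumannEntropy σ + vonNeumannEntropy (spinPartialTrace (embS A S B) σ) ≤
      vonNeumannEntropy (spinPartialTrace (embAS A S B) σ) +
        vonNeumannEntropy (spinPartialTrace (Function.Embedding.inr : S ⊕ B ↪ A ⊕ (S ⊕ B)) σ) := by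
  have hρ : IsDensity (toProd3 σ) := by
    refine ⟨hσ.submatrix _, ?_⟩
    rw [toProd3, trace_submatrix_equiv_equiv, htr]
  have hH3 : (traceLast (toProd3 σ)).IsHermitian := (posSemidef_traceRight (hρ.1.submatrix _)).isHermitian
  have hH1 : (traceLeft (toProd3 σ)).IsHermitian := (posSemidef_traceLeft hρ.1).isHermitian
  have e0 : vonNeumannEntropy σ = vonNeumannEntropy (toProd3 σ) := by
    rw [toProd3, vonNeumannEntropy_submatrix_equiv hσ.isHermitian]
  have e1 : vonNeumannEntropy (spinPartialTrace (embAS A S B) σ) = vonNeumannEntropy (traceLast (toProd3 σ)) := by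
    rw [spinPartialTrace_embAS_eq_traceLast]
    exact vonNeumannEntropy_submatrix_equiv hH3 _
  have e3 : vonNeumannEntropy (spinPartialTrace (Function.Embedding.inr : S ⊕ B ↪ A ⊕ (S ⊕ B)) σ) =
      vonNeumannEntropy (traceLeft (toProd3 σ)) := by
    rw [spinPartialTrace_inr_eq_traceLeft]
    exact vonNeumannEntropy_submatrix_equiv hH1 _
  rw [e0, e1, e3, spinPartialTrace_embS_eq_traceLeft_traceLast]
  exact strongSubadditivity_of_relEntropy_partialTrace_le relEntropy_partialTrace_le_holds (toProd3 σ) hρ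

/-- **Strong subadditivity, for a window on any site type** identified with three blocks by
`ε : Y ≃ A ⊕ (S ⊕ B)`, the sub-windows `AS`, `SB`, `S` being given by site embeddings into `Y` that `ε`
carries to the standard blocks. [cite: LiebRuskai1973, Theorem 2] [cite: NielsenChuang2010, Theorem 11.14] -/
theorem spin_strongSubadditivity' {Y AS SB : Type} [Fintype Y] [DecidableEq Y]
    [Fintype AS] [DecidableEq AS] [Fintype SB] [DecidableEq SB]
    (ε : Y ≃ A ⊕ (S ⊕ B)) (εAS : AS ≃ A ⊕ S) (εSB : SB ≃ S ⊕ B)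
    {φAS : AS ↪ Y} {φSB : SB ↪ Y} {φS : S ↪ Y}
    (hAS : φAS = (εAS.toEmbedding.trans (embAS A S B)).trans ε.symm.toEmbedding)
    (hSB : φSB = (εSB.toEmbedding.trans (Function.Embedding.inr : S ⊕ B ↪ A ⊕ (S ⊕ B))).trans
      ε.symm.toEmbedding)
    (hS : φS = (embS A S B).trans ε.symm.toEmbedding)
    (σ : Op Y q) (hσ : σ.PosSemidef) (htr : σ.trace = 1) :
    vonNeumannEntropy σ + vonNeumannEntropy (spinPartialTrace φS σ) ≤
      vonNeumannEntropy (spinPartialTrace φAS σ) + vonNeumannEntropy (spinPartialTrace φSB σ) := by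
  set σ' : Op (A ⊕ (S ⊕ B)) q := reindexOp ε σ with hσ'
  have hre : spinPartialTrace ε.symm.toEmbedding σ = σ' := by
    rw [hσ', spinPartialTrace_equiv, Equiv.symm_symm]
  have hσ'psd : σ'.PosSemidef := by rw [← hre]; exact posSemidef_spinPartialTrace _ hσ
  have hσ'tr : σ'.trace = 1 := by rw [hσ', trace_reindexOp, htr]
  have eS : spinPartialTrace φS σ = spinPartialTrace (embS A S B) σ' := by
    rw [hS, spinPartialTrace_trans, hre]
  have eAS : spinPartialTrace φAS σ = reindexOp εAS.symm (spinPartialTrace (embAS A S B) σ') := by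
    rw [hAS, spinPartialTrace_trans, spinPartialTrace_trans, hre, spinPartialTrace_equiv]
  have eSB : spinPartialTrace φSB σ =
      reindexOp εSB.symm (spinPartialTrace (Function.Embedding.inr : S ⊕ B ↪ A ⊕ (S ⊕ B)) σ') := by
    rw [hSB, spinPartialTrace_trans, spinPartialTrace_trans, hre, spinPartialTrace_equiv]
  have hHAS : (spinPartialTrace (embAS A S B) σ').IsHermitian :=
    isHermitian_spinPartialTrace _ hσ'psd.isHermitian
  have hHSB : (spinPartialTrace (Function.Embedding.inr : S ⊕ B ↪ A ⊕ (S ⊕ B)) σ').IsHermitian :=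
    isHermitian_spinPartialTrace _ hσ'psd.isHermitian
  have e0 : vonNeumannEntropy σ = vonNeumannEntropy σ' := by
    rw [hσ', vonNeumannEntropy_reindexOp ε hσ.isHermitian]
  rw [eAS, vonNeumannEntropy_reindexOp εAS.symm hHAS, eSB, vonNeumannEntropy_reindexOp εSB.symm hHSB, eS, e0]
  exact spin_strongSubadditivity σ' hσ'psd hσ'tr

end Spin

/-! ### §2. The three consecutive blocks `P < Q < R` of a lattice fermion system -/

section Blocks

variable {α β : Type} [LinearOrder α] [LinearOrder β]

/-- The initial block `α ↪o α ⊕ₗ β`. [folklore] -/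
def blockInlO : α ↪o α ⊕ₗ β :=
  OrderEmbedding.ofStrictMono (fun a => toLex (Sum.inl a)) Sum.Lex.inl_strictMono

/-- The final block `β ↪o α ⊕ₗ β`. [folklore] -/
def blockInrO : β ↪o α ⊕ₗ β :=
  OrderEmbedding.ofStrictMono (fun b => toLex (Sum.inr b)) Sum.Lex.inr_strictMono

/-- `blockInlO a = inl a`. [folklore] -/
@[simp] private theorem blockInlO_apply (a : α) : (blockInlO a : α ⊕ₗ β) = toLex (Sum.inl a) := rfl

/-- `blockInrO b = inr b`. [folklore] -/
@[simp] private theorem blockInrO_apply (b : β) : (blockInrO b : α ⊕ₗ β) = toLex (Sum.inr b) := rfl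

/-- The initial block is an initial segment. [folklore] -/
private theorem isLowerSet_range_blockInlO : IsLowerSet (Set.range (blockInlO : α ↪o α ⊕ₗ β)) := by
  rintro a b hba ⟨x, rfl⟩
  obtain ⟨b, rfl⟩ := toLex.surjective b
  rcases b with y | y
  · exact ⟨y, rfl⟩
  · exact absurd hba Sum.Lex.not_inr_le_inl

/-- The final block is a final segment. [folklore] -/
private theorem isUpperSet_range_blockInrO : IsUpperSet (Set.range (blockInrO : β ↪o α ⊕ₗ β)) := by
  rintro a b hab ⟨x, rfl⟩
  obtain ⟨b, rfl⟩ := toLex.surjective b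
  rcases b with y | y
  · exact absurd hab Sum.Lex.not_inr_le_inl
  · exact ⟨y, rfl⟩

variable {P Q R : Type} [LinearOrder P] [LinearOrder Q] [LinearOrder R]

/-- The site map of the first two blocks, `P ⊕ₗ Q → P ⊕ₗ (Q ⊕ₗ R)`. [folklore] -/
def blockPQFun (x : P ⊕ₗ Q) : P ⊕ₗ (Q ⊕ₗ R) :=
  Sum.elim (fun p => toLex (Sum.inl p)) (fun q => toLex (Sum.inr (toLex (Sum.inl q)))) (ofLex x)

omit [LinearOrder P] [LinearOrder Q] [LinearOrder R] in
/-- `blockPQFun (inl p) = inl p`. [folklore] -/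
@[simp] private theorem blockPQFun_inl (p : P) :
    (blockPQFun (toLex (Sum.inl p)) : P ⊕ₗ (Q ⊕ₗ R)) = toLex (Sum.inl p) := rfl

omit [LinearOrder P] [LinearOrder Q] [LinearOrder R] in
/-- `blockPQFun (inr q) = inr (inl q)`. [folklore] -/
@[simp] private theorem blockPQFun_inr (q : Q) :
    (blockPQFun (toLex (Sum.inr q)) : P ⊕ₗ (Q ⊕ₗ R)) = toLex (Sum.inr (toLex (Sum.inl q))) := rfl

/-- `blockPQFun` is strictly monotone. [folklore] -/
private theorem blockPQFun_strictMono : StrictMono (blockPQFun : P ⊕ₗ Q → P ⊕ₗ (Q ⊕ₗ R)) := by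
  intro x y hxy
  obtain ⟨x, rfl⟩ := toLex.surjective x
  obtain ⟨y, rfl⟩ := toLex.surjective y
  rcases x with p | q <;> rcases y with p' | q'
  · rw [blockPQFun_inl, blockPQFun_inl]
    exact (Sum.Lex.inl_lt_inl_iff (β := Q ⊕ₗ R)).2 ((Sum.Lex.inl_lt_inl_iff (β := Q)).1 hxy)
  · rw [blockPQFun_inl, blockPQFun_inr]
    exact Sum.Lex.inl_lt_inr _ _
  · exact absurd hxy Sum.Lex.not_inr_lt_inl
  · rw [blockPQFun_inr, blockPQFun_inr]
    exact (Sum.Lex.inr_lt_inr_iff (α := P)).2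
      ((Sum.Lex.inl_lt_inl_iff (β := R)).2 ((Sum.Lex.inr_lt_inr_iff (α := P)).1 hxy))

/-- The first two blocks `P ⊕ₗ Q ↪o P ⊕ₗ (Q ⊕ₗ R)` as an order embedding. [folklore] -/
def blockPQO : P ⊕ₗ Q ↪o P ⊕ₗ (Q ⊕ₗ R) :=
  OrderEmbedding.ofStrictMono blockPQFun blockPQFun_strictMono

/-- `blockPQO x = blockPQFun x`. [folklore] -/
@[simp] private theorem blockPQO_apply (x : P ⊕ₗ Q) : (blockPQO x : P ⊕ₗ (Q ⊕ₗ R)) = blockPQFun x := rfl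

/-- The first two blocks form an initial segment. [folklore] -/
private theorem isLowerSet_range_blockPQO : IsLowerSet (Set.range (blockPQO : P ⊕ₗ Q ↪o P ⊕ₗ (Q ⊕ₗ R))) := by
  rintro a b hba ⟨x, rfl⟩
  obtain ⟨b, rfl⟩ := toLex.surjective b
  rcases b with p | y
  · exact ⟨toLex (Sum.inl p), rfl⟩
  · obtain ⟨y, rfl⟩ := toLex.surjective y
    rcases y with q | r
    · exact ⟨toLex (Sum.inr q), rfl⟩
    · exfalso
      obtain ⟨x, rfl⟩ := toLex.surjective x
      rcases x with p | q
      · rw [blockPQO_apply, blockPQFun_inl] at hba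
        exact Sum.Lex.not_inr_le_inl hba
      · rw [blockPQO_apply, blockPQFun_inr] at hba
        exact Sum.Lex.not_inr_le_inl ((Sum.Lex.inr_le_inr_iff (α := P)).1 hba)

/-- The site bijection forgetting the block order, `P ⊕ₗ (Q ⊕ₗ R) ≃ P ⊕ (Q ⊕ R)`. [folklore] -/
def blockEquiv (P Q R : Type) : P ⊕ₗ (Q ⊕ₗ R) ≃ P ⊕ (Q ⊕ R) :=
  (ofLex : P ⊕ₗ (Q ⊕ₗ R) ≃ P ⊕ (Q ⊕ₗ R)).trans (Equiv.sumCongr (Equiv.refl P) (ofLex : Q ⊕ₗ R ≃ Q ⊕ R))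

/-- The `PQ` block embedding is `embAS` read through the block bijections. [folklore] -/
private theorem blockPQO_eq_embAS :
    (blockPQO : P ⊕ₗ Q ↪o P ⊕ₗ (Q ⊕ₗ R)).toEmbedding =
      (((ofLex : P ⊕ₗ Q ≃ P ⊕ Q)).toEmbedding.trans (embAS P Q R)).trans (blockEquiv P Q R).symm.toEmbedding := by
  refine DFunLike.ext _ _ fun x => ?_
  obtain ⟨x, rfl⟩ := toLex.surjective x
  rcases x with p | q <;> rfl

/-- The `QR` block embedding is `Sum.inr` read through the block bijections. [folklore] -/
private theorem blockInrO_eq_inr :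
    (blockInrO : Q ⊕ₗ R ↪o P ⊕ₗ (Q ⊕ₗ R)).toEmbedding =
      (((ofLex : Q ⊕ₗ R ≃ Q ⊕ R)).toEmbedding.trans
        (Function.Embedding.inr : Q ⊕ R ↪ P ⊕ (Q ⊕ R))).trans (blockEquiv P Q R).symm.toEmbedding := by
  refine DFunLike.ext _ _ fun x => ?_
  obtain ⟨x, rfl⟩ := toLex.surjective x
  rcases x with q | r <;> rfl

/-- The `Q` block embedding is `embS` read through the block bijection. [folklore] -/
private theorem blockQ_eq_embS :
    (blockInlO : Q ↪o Q ⊕ₗ R).toEmbedding.trans (blockInrO : Q ⊕ₗ R ↪o P ⊕ₗ (Q ⊕ₗ R)).toEmbedding =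
      (embS P Q R).trans (blockEquiv P Q R).symm.toEmbedding := by
  refine DFunLike.ext _ _ fun q => ?_
  rfl

end Blocks

/-! ### §2b. Fermionic strong subadditivity in block form -/

section FermionBlocks

open JordanWigner

variable {P Q R : Type} [LinearOrder P] [Fintype P] [LinearOrder Q] [Fintype Q] [LinearOrder R] [Fintype R]

/-- **Fermionic SSA, block form.** For an even density matrix `ρ` on the Fock space of the three
consecutive blocks `P < Q < R`:
`S(ρ) + S(ρ_Q) ≤ S(ρ_{PQ}) + S(ρ_{QR})` with the CAR marginals `fermionPartialTrace`. Initial segment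
`PQ`: CAR = spin marginal; final segment `QR`: CAR = spin marginal because `ρ` is even; `Q` = initial
segment of `QR`; then Lieb–Ruskai on `ℋ_P ⊗ ℋ_Q ⊗ ℋ_R`. [cite: ArakiMoriya2003, Theorem 3.8 and §10]
[cite: LiebRuskai1973, Theorem 2] -/
theorem fermion_strongSubadditivity_blocks
    (ρ : Matrix (Finset (Orb (P ⊕ₗ (Q ⊕ₗ R)))) (Finset (Orb (P ⊕ₗ (Q ⊕ₗ R)))) ℂ)
    (hρ : ρ.PosSemidef) (htr : ρ.trace = 1) (hev : parityAut ρ = ρ) :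
    vonNeumannEntropy ρ +
        vonNeumannEntropy (fermionPartialTrace
          ((blockInlO : Q ↪o Q ⊕ₗ R).toEmbedding.trans (blockInrO : Q ⊕ₗ R ↪o P ⊕ₗ (Q ⊕ₗ R)).toEmbedding) ρ) ≤
      vonNeumannEntropy (fermionPartialTrace (blockPQO : P ⊕ₗ Q ↪o P ⊕ₗ (Q ⊕ₗ R)).toEmbedding ρ) +
        vonNeumannEntropy (fermionPartialTrace (blockInrO : Q ⊕ₗ R ↪o P ⊕ₗ (Q ⊕ₗ R)).toEmbedding ρ) := by
  /- Implementation note: on the lexicographic block types several instance paths to `DecidableEq` /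
  `Fintype` coexist (through the linear order or structurally through `Lex`/`Sum`); they are
  definitionally equal but not reducibly so, hence every intermediate identity below is STATED in the
  ambient context and proved by `exact`, and only such identities are rewritten. -/
  have hσ : (toSpin ρ).PosSemidef := (posSemidef_toSpin_iff ρ).2 hρ
  have hσtr : (toSpin ρ).trace = 1 := (trace_toSpin ρ).trans htr
  have key := spin_strongSubadditivity' (blockEquiv P Q R) (ofLex : P ⊕ₗ Q ≃ P ⊕ Q) (ofLex : Q ⊕ₗ R ≃ Q ⊕ R)
    blockPQO_eq_embAS blockInrO_eq_inr blockQ_eq_embS (toSpin ρ) hσ hσtr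
  have e0 : vonNeumannEntropy ρ = vonNeumannEntropy (toSpin ρ) := (vonNeumannEntropy_toSpin hρ.isHermitian).symm
  have eI : vonNeumannEntropy (fermionPartialTrace (blockPQO : P ⊕ₗ Q ↪o P ⊕ₗ (Q ⊕ₗ R)).toEmbedding ρ) =
      vonNeumannEntropy (spinPartialTrace (blockPQO : P ⊕ₗ Q ↪o P ⊕ₗ (Q ⊕ₗ R)).toEmbedding (toSpin ρ)) :=
    vonNeumannEntropy_fermionPartialTrace_of_isLowerSet _ isLowerSet_range_blockPQO hρ.isHermitian
  have eJ : vonNeumannEntropy (fermionPartialTrace (blockInrO : Q ⊕ₗ R ↪o P ⊕ₗ (Q ⊕ₗ R)).toEmbedding ρ) =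
      vonNeumannEntropy (spinPartialTrace (blockInrO : Q ⊕ₗ R ↪o P ⊕ₗ (Q ⊕ₗ R)).toEmbedding (toSpin ρ)) :=
    vonNeumannEntropy_fermionPartialTrace_of_isUpperSet_of_even _ isUpperSet_range_blockInrO hev hρ.isHermitian
  have h1 : fermionPartialTrace ((blockInlO : Q ↪o Q ⊕ₗ R).toEmbedding.trans
        (blockInrO : Q ⊕ₗ R ↪o P ⊕ₗ (Q ⊕ₗ R)).toEmbedding) ρ =
      fermionPartialTrace (blockInlO : Q ↪o Q ⊕ₗ R).toEmbedding
        (fermionPartialTrace (blockInrO : Q ⊕ₗ R ↪o P ⊕ₗ (Q ⊕ₗ R)).toEmbedding ρ) :=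
    fermionPartialTrace_trans _ _ ρ
  have h2 : spinPartialTrace ((blockInlO : Q ↪o Q ⊕ₗ R).toEmbedding.trans
        (blockInrO : Q ⊕ₗ R ↪o P ⊕ₗ (Q ⊕ₗ R)).toEmbedding) (toSpin ρ) =
      spinPartialTrace (blockInlO : Q ↪o Q ⊕ₗ R).toEmbedding
        (spinPartialTrace (blockInrO : Q ⊕ₗ R ↪o P ⊕ₗ (Q ⊕ₗ R)).toEmbedding (toSpin ρ)) :=
    spinPartialTrace_trans _ _ _
  have h3 : toSpin (fermionPartialTrace (blockInrO : Q ⊕ₗ R ↪o P ⊕ₗ (Q ⊕ₗ R)).toEmbedding ρ) =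
      spinPartialTrace (blockInrO : Q ⊕ₗ R ↪o P ⊕ₗ (Q ⊕ₗ R)).toEmbedding (toSpin ρ) :=
    toSpin_fermionPartialTrace_of_isUpperSet_of_even _ isUpperSet_range_blockInrO hev
  have h4 : vonNeumannEntropy (fermionPartialTrace (blockInlO : Q ↪o Q ⊕ₗ R).toEmbedding
        (fermionPartialTrace (blockInrO : Q ⊕ₗ R ↪o P ⊕ₗ (Q ⊕ₗ R)).toEmbedding ρ)) =
      vonNeumannEntropy (spinPartialTrace (blockInlO : Q ↪o Q ⊕ₗ R).toEmbedding
        (toSpin (fermionPartialTrace (blockInrO : Q ⊕ₗ R ↪o P ⊕ₗ (Q ⊕ₗ R)).toEmbedding ρ))) :=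
    vonNeumannEntropy_fermionPartialTrace_of_isLowerSet _ isLowerSet_range_blockInlO
      (isHermitian_fermionPartialTrace _ hρ.isHermitian)
  have eK : vonNeumannEntropy (fermionPartialTrace ((blockInlO : Q ↪o Q ⊕ₗ R).toEmbedding.trans
        (blockInrO : Q ⊕ₗ R ↪o P ⊕ₗ (Q ⊕ₗ R)).toEmbedding) ρ) =
      vonNeumannEntropy (spinPartialTrace ((blockInlO : Q ↪o Q ⊕ₗ R).toEmbedding.trans
        (blockInrO : Q ⊕ₗ R ↪o P ⊕ₗ (Q ⊕ₗ R)).toEmbedding) (toSpin ρ)) := by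
    rw [h1, h2, h4, h3]
  rw [e0, eI, eJ, eK]
  exact key

end FermionBlocks

/-! ### §3. Strong subadditivity for even states of the lattice fermion system -/

section Fermion

variable {Λ' ΛI ΛJ ΛK ΛU : Type} [LinearOrder Λ'] [Fintype Λ'] [LinearOrder ΛI] [Fintype ΛI]
  [LinearOrder ΛJ] [Fintype ΛJ] [LinearOrder ΛK] [Fintype ΛK] [LinearOrder ΛU] [Fintype ΛU]

/-- **Strong subadditivity of the entropy for even states of a lattice fermion system** (Araki–Moriya).
Let `ρ` be an even density matrix on the Fock space over the sites `Λ'`, and let `φ_I, φ_J, φ_K, φ_U` be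
site injections with `im φ_K = im φ_I ∩ im φ_J` and `im φ_U = im φ_I ∪ im φ_J`. Then the entropies of the
CAR marginals satisfy `S(ρ_{I∪J}) + S(ρ_{I∩J}) ≤ S(ρ_I) + S(ρ_J)`. Proof in the module docstring
(restriction to `I ∪ J`, re-ordering into blocks `I∖J < I∩J < J∖I`, Jordan–Wigner dictionary on
initial/final segments, Lieb–Ruskai). [cite: ArakiMoriya2003, Theorem 3.8 and §10]
[cite: LiebRuskai1973, Theorem 2] -/
theorem fermion_strongSubadditivity (φI : ΛI ↪ Λ') (φJ : ΛJ ↪ Λ') (φK : ΛK ↪ Λ') (φU : ΛU ↪ Λ')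
    (hK : Set.range φK = Set.range φI ∩ Set.range φJ) (hU : Set.range φU = Set.range φI ∪ Set.range φJ)
    {ρ : Matrix (Finset (Orb Λ')) (Finset (Orb Λ')) ℂ} (hρ : ρ.PosSemidef) (htr : ρ.trace = 1)
    (hev : parityAut ρ = ρ) :
    vonNeumannEntropy (fermionPartialTrace φU ρ) + vonNeumannEntropy (fermionPartialTrace φK ρ) ≤
      vonNeumannEntropy (fermionPartialTrace φI ρ) + vonNeumannEntropy (fermionPartialTrace φJ ρ) := by
  classical
  -- the three blocks as subtypes of `Λ'`
  let P : Type := {y : Λ' // y ∈ Set.range φI ∧ y ∉ Set.range φJ}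
  let Q : Type := {y : Λ' // y ∈ Set.range φI ∧ y ∈ Set.range φJ}
  let R : Type := {y : Λ' // y ∉ Set.range φI ∧ y ∈ Set.range φJ}
  -- the block site map
  let g : P ⊕ₗ (Q ⊕ₗ R) → Λ' := fun x =>
    Sum.elim (fun p : P => p.1) (fun y : Q ⊕ₗ R => Sum.elim (fun q : Q => q.1) (fun r : R => r.1) (ofLex y))
      (ofLex x)
  have hg_inl : ∀ p : P, g (toLex (Sum.inl p)) = p.1 := fun _ => rfl
  have hg_q : ∀ q : Q, g (toLex (Sum.inr (toLex (Sum.inl q)))) = q.1 := fun _ => rfl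
  have hg_r : ∀ r : R, g (toLex (Sum.inr (toLex (Sum.inr r)))) = r.1 := fun _ => rfl
  have hg : Function.Injective g := by
    intro x y hxy
    obtain ⟨x, rfl⟩ := toLex.surjective x
    obtain ⟨y, rfl⟩ := toLex.surjective y
    rcases x with p | x <;> rcases y with p' | y
    · rw [hg_inl, hg_inl] at hxy
      rw [Subtype.ext hxy]
    · exfalso
      obtain ⟨y, rfl⟩ := toLex.surjective y
      rcases y with q | r
      · rw [hg_inl, hg_q] at hxy; exact p.2.2 (hxy ▸ q.2.2)
      · rw [hg_inl, hg_r] at hxy; exact p.2.2 (hxy ▸ r.2.2)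
    · exfalso
      obtain ⟨x, rfl⟩ := toLex.surjective x
      rcases x with q | r
      · rw [hg_inl, hg_q] at hxy; exact p'.2.2 (hxy ▸ q.2.2)
      · rw [hg_inl, hg_r] at hxy; exact p'.2.2 (hxy ▸ r.2.2)
    · obtain ⟨x, rfl⟩ := toLex.surjective x
      obtain ⟨y, rfl⟩ := toLex.surjective y
      rcases x with q | r <;> rcases y with q' | r'
      · rw [hg_q, hg_q] at hxy; rw [Subtype.ext hxy]
      · rw [hg_q, hg_r] at hxy; exact absurd (hxy ▸ q.2.1) r'.2.1
      · rw [hg_r, hg_q] at hxy; exact absurd (hxy ▸ q'.2.1) r.2.1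
      · rw [hg_r, hg_r] at hxy; rw [Subtype.ext hxy]
  let ψ : P ⊕ₗ (Q ⊕ₗ R) ↪ Λ' := ⟨g, hg⟩
  -- ranges of the block injections
  have hψ : ∀ x, ψ x = g x := fun _ => rfl
  have rU : Set.range ψ = Set.range φU := by
    rw [hU]
    ext y
    constructor
    · rintro ⟨x, rfl⟩
      obtain ⟨x, rfl⟩ := toLex.surjective x
      rcases x with p | x
      · exact Or.inl (by rw [hψ, hg_inl]; exact p.2.1)
      · obtain ⟨x, rfl⟩ := toLex.surjective x
        rcases x with q | r
        · exact Or.inl (by rw [hψ, hg_q]; exact q.2.1)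
        · exact Or.inr (by rw [hψ, hg_r]; exact r.2.2)
    · intro hy
      by_cases hI : y ∈ Set.range φI
      · by_cases hJ : y ∈ Set.range φJ
        · exact ⟨toLex (Sum.inr (toLex (Sum.inl (⟨y, hI, hJ⟩ : Q)))), rfl⟩
        · exact ⟨toLex (Sum.inl (⟨y, hI, hJ⟩ : P)), rfl⟩
      · have hJ : y ∈ Set.range φJ := hy.resolve_left hI
        exact ⟨toLex (Sum.inr (toLex (Sum.inr (⟨y, hI, hJ⟩ : R)))), rfl⟩
  have rI : Set.range ((blockPQO : P ⊕ₗ Q ↪o P ⊕ₗ (Q ⊕ₗ R)).toEmbedding.trans ψ) = Set.range φI := by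
    ext y
    constructor
    · rintro ⟨x, rfl⟩
      obtain ⟨x, rfl⟩ := toLex.surjective x
      rcases x with p | q
      · rw [Function.Embedding.trans_apply, RelEmbedding.coe_toEmbedding, blockPQO_apply, blockPQFun_inl, hψ,
          hg_inl]; exact p.2.1
      · rw [Function.Embedding.trans_apply, RelEmbedding.coe_toEmbedding, blockPQO_apply, blockPQFun_inr, hψ,
          hg_q]; exact q.2.1
    · intro hI
      by_cases hJ : y ∈ Set.range φJ
      · exact ⟨toLex (Sum.inr (⟨y, hI, hJ⟩ : Q)), rfl⟩
      · exact ⟨toLex (Sum.inl (⟨y, hI, hJ⟩ : P)), rfl⟩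
  have rJ : Set.range ((blockInrO : Q ⊕ₗ R ↪o P ⊕ₗ (Q ⊕ₗ R)).toEmbedding.trans ψ) = Set.range φJ := by
    ext y
    constructor
    · rintro ⟨x, rfl⟩
      obtain ⟨x, rfl⟩ := toLex.surjective x
      rcases x with q | r
      · rw [Function.Embedding.trans_apply, RelEmbedding.coe_toEmbedding, blockInrO_apply, hψ, hg_q]; exact q.2.2
      · rw [Function.Embedding.trans_apply, RelEmbedding.coe_toEmbedding, blockInrO_apply, hψ, hg_r]; exact r.2.2
    · intro hJ
      by_cases hI : y ∈ Set.range φI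
      · exact ⟨toLex (Sum.inl (⟨y, hI, hJ⟩ : Q)), rfl⟩
      · exact ⟨toLex (Sum.inr (⟨y, hI, hJ⟩ : R)), rfl⟩
  have rK : Set.range (((blockInlO : Q ↪o Q ⊕ₗ R).toEmbedding.trans
      (blockInrO : Q ⊕ₗ R ↪o P ⊕ₗ (Q ⊕ₗ R)).toEmbedding).trans ψ) = Set.range φK := by
    rw [hK]
    ext y
    constructor
    · rintro ⟨q, rfl⟩
      rw [Function.Embedding.trans_apply, Function.Embedding.trans_apply, RelEmbedding.coe_toEmbedding,
        RelEmbedding.coe_toEmbedding, blockInlO_apply, blockInrO_apply, hψ, hg_q]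
      exact q.2
    · rintro ⟨hI, hJ⟩
      exact ⟨(⟨y, hI, hJ⟩ : Q), rfl⟩
  -- transport the state to the blocks
  set ρ' := fermionPartialTrace ψ ρ with hρ'
  have hρ'psd : ρ'.PosSemidef := posSemidef_fermionPartialTrace ψ hρ
  have hρ'tr : ρ'.trace = 1 := by rw [hρ', trace_fermionPartialTrace, htr]
  have hρ'ev : parityAut ρ' = ρ' := parityAut_fermionPartialTrace_of_even ψ hev
  have eU : vonNeumannEntropy (fermionPartialTrace φU ρ) = vonNeumannEntropy ρ' :=
    (vonNeumannEntropy_fermionPartialTrace_eq_of_range_eq ψ φU rU hρ.isHermitian).symm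
  have eI : vonNeumannEntropy (fermionPartialTrace φI ρ) =
      vonNeumannEntropy (fermionPartialTrace (blockPQO : P ⊕ₗ Q ↪o P ⊕ₗ (Q ⊕ₗ R)).toEmbedding ρ') := by
    rw [hρ', ← fermionPartialTrace_trans]
    exact (vonNeumannEntropy_fermionPartialTrace_eq_of_range_eq _ φI rI hρ.isHermitian).symm
  have eJ : vonNeumannEntropy (fermionPartialTrace φJ ρ) =
      vonNeumannEntropy (fermionPartialTrace (blockInrO : Q ⊕ₗ R ↪o P ⊕ₗ (Q ⊕ₗ R)).toEmbedding ρ') := by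
    rw [hρ', ← fermionPartialTrace_trans]
    exact (vonNeumannEntropy_fermionPartialTrace_eq_of_range_eq _ φJ rJ hρ.isHermitian).symm
  have eK : vonNeumannEntropy (fermionPartialTrace φK ρ) =
      vonNeumannEntropy (fermionPartialTrace ((blockInlO : Q ↪o Q ⊕ₗ R).toEmbedding.trans
        (blockInrO : Q ⊕ₗ R ↪o P ⊕ₗ (Q ⊕ₗ R)).toEmbedding) ρ') := by
    rw [hρ', ← fermionPartialTrace_trans]
    exact (vonNeumannEntropy_fermionPartialTrace_eq_of_range_eq _ φK rK hρ.isHermitian).symm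
  rw [eU, eI, eJ, eK]
  exact fermion_strongSubadditivity_blocks ρ' hρ'psd hρ'tr hρ'ev

/-- Over an EMPTY site type the Fock space is one-dimensional (only the vacuum configuration), so every
trace-one Hermitian matrix on it — e.g. the marginal of a state on the empty region — has entropy `0`
(a pure state). [cite: NielsenChuang2010, Theorem 11.8 (1) p.513] -/
theorem vonNeumannEntropy_eq_zero_of_isEmpty {Λ : Type} [LinearOrder Λ] [Fintype Λ] [IsEmpty Λ]
    {ρ : Matrix (Finset (Orb Λ)) (Finset (Orb Λ)) ℂ} (hρ : ρ.IsHermitian) (htr : ρ.trace = 1) :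
    vonNeumannEntropy ρ = 0 := by
  have hsub : ∀ s : Finset (Orb Λ), s = ∅ := fun s =>
    Finset.eq_empty_of_forall_notMem fun o _ => isEmptyElim (ofLex o).1
  haveI : Subsingleton (Finset (Orb Λ)) := ⟨fun s t => by rw [hsub s, hsub t]⟩
  rw [Literature.InformationTheory.Entropy.vonNeumannEntropy_eq hρ]
  have hsum := Literature.InformationTheory.Entropy.sum_eigenvalues_eq_one hρ htr
  rw [Fintype.sum_subsingleton _ (∅ : Finset (Orb Λ))] at hsum ⊢
  rw [hsum, Real.negMulLog_one]

/-- **Subadditivity for even states of a lattice fermion system**: for disjoint regions,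
`S(ρ_{I ∪ J}) ≤ S(ρ_I) + S(ρ_J)` (SSA with `I ∩ J = ∅`, the marginal on the empty region having entropy
`0`). [cite: ArakiMoriya2003, Theorem 3.8 and §10] -/
theorem fermion_subadditivity (φI : ΛI ↪ Λ') (φJ : ΛJ ↪ Λ') (φU : ΛU ↪ Λ')
    (hdisj : Disjoint (Set.range φI) (Set.range φJ)) (hU : Set.range φU = Set.range φI ∪ Set.range φJ)
    {ρ : Matrix (Finset (Orb Λ')) (Finset (Orb Λ')) ℂ} (hρ : ρ.PosSemidef) (htr : ρ.trace = 1)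
    (hev : parityAut ρ = ρ) :
    vonNeumannEntropy (fermionPartialTrace φU ρ) ≤
      vonNeumannEntropy (fermionPartialTrace φI ρ) + vonNeumannEntropy (fermionPartialTrace φJ ρ) := by
  let φK : Fin 0 ↪ Λ' := ⟨fun x => x.elim0, fun x => x.elim0⟩
  have hK : Set.range φK = Set.range φI ∩ Set.range φJ := by
    rw [Set.disjoint_iff_inter_eq_empty.1 hdisj, Set.range_eq_empty]
  have h := fermion_strongSubadditivity φI φJ φK φU hK hU hρ htr hev
  have h0 : vonNeumannEntropy (fermionPartialTrace φK ρ) = 0 :=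
    vonNeumannEntropy_eq_zero_of_isEmpty (isHermitian_fermionPartialTrace φK hρ.isHermitian)
      (by rw [trace_fermionPartialTrace, htr])
  linarith

end Fermion

end Literature.MathematicalPhysics.QuantumLattice

end
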